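import Mathlib
import HarnessLib
import Summits.Langlands.Langlands.Theses.SkinnerWilesDefectOne
import Summits.Langlands.Langlands.Theorems.SkinnerWilesDefectOneReducibleOrdinaryProModularDefs
import Summits.Langlands.Langlands.Theorems.SkinnerWilesDefectOneProModularOfEisensteinSeedProModularPoints
import Summits.Langlands.Langlands.Theorems.SkinnerWilesDefectOneProModularOfEisensteinSeedProModularEntrance
import Literature.NumberTheory.GaloisRepresentations.PadicIntermediateFieldIntegers

/-!
# Points of `R_𝒟` over `𝒪_E`: automatic continuity, units `q_v`, and the dictionary unconditionally

Route `SkinnerWilesDefectOne`, support item stmt-Langlands-14718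
(`ProModularOfEisensteinSeed : EisensteinProModularSeed → ReducibleOrdinaryProModular`).  The landed
point/prime dictionary (`isPadicallyAutomorphic_of_isProModularPrimeAt_ker`, EXIT, and
`isProModularPrimeAt_ker_of_isPadicallyAutomorphic`, ENTRANCE) carries two honest hypotheses:
continuity of `φ : R_𝒟 → ℚ̄_p` and `q_v ∈ R_𝒟ˣ`.  In the only case the route uses — `φ` the
classifying map of an `𝒪_E`-lattice, i.e. `φ = (𝒪_E ⊆ E ⊆ ℚ̄_p) ∘ ψ` for a ring homomorphism
`ψ : R_𝒟 → 𝒪_E = intermediateFieldIntegers p E`, `E/ℚ_p` finite (the shape produced by stub S2,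
`stub_orientedSteinbergDatum_auxDatum`) — both are AUTOMATIC, and this file discharges them:

* `map_maximalIdeal_le_of_finite_residueField` — ANY ring homomorphism from a local ring to a local
  ring with FINITE residue field is local (the kernel of `R → A → k_A` is a prime with finite, hence
  field, quotient: it is `𝔪_R`);
* `continuous_coe_comp_intermediateFieldIntegers` — hence `φ = coe ∘ ψ` is continuous from the
  `𝔪_{R_𝒟}`-adic topology to `ℚ̄_p` (`ψ(𝔪ⁿ) ⊆ 𝔪_Eⁿ = (ϖⁿ)` has norm `≤ ‖ϖ‖ⁿ → 0`, the tree's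
  `mem_maximalIdeal_pow_iff`, `norm_uniformizer_lt_one`);
* `isUnit_natCast_of_not_dvd` — for a local ring with residue characteristic `p`, every natural number
  prime to `p` is a unit; `not_dvd_absNorm_of_not_mem` — `p ∤ N(v)` for `v ∤ p`; so `q_v = N(v) ∈ R_𝒟ˣ`
  for every `v ∉ S ⊇ {v ∣ p}`;
* `isProModularPrimeAt_ker_of_isPadicallyAutomorphic_intermediateFieldIntegers` (ENTRANCE) and
  `isPadicallyAutomorphic_of_isProModularPrimeAt_ker_intermediateFieldIntegers` (EXIT) — the dictionary
  for `𝒪_E`-valued points with NO topological or unit hypothesis left: `k` finite of characteristic `p`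
  and `ψ : R_𝒟 → 𝒪_E` a ring homomorphism realising `r` up to `GL₂(ℚ̄_p)`-conjugation.

References: C. M. Skinner, A. J. Wiles, Publ. Math. IHÉS 89 (1999), §4.1 (p. 62); J.-P. Serre, *Local
Fields*, Ch. II §1. [SkinnerWiles1999] [SerreLocalFields1979]
-/

set_option linter.dupNamespace false -- project-wide option (lakefile weak.linter.dupNamespace); `Summit.Langlands.Langlands` is the mandated namespace

namespace Summit.Langlands.Langlands.Cruxes.ReducibleOrdinaryProModular.SteinbergHyperplane

open scoped NumberField MatrixGroups
open IsDedekindDomain Field Polynomial Matrix IsLocalRing Filter Topology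
open Literature.NumberTheory.Automorphic Literature.NumberTheory.Automorphic.BigHeckeGLn
open Literature.NumberTheory.GaloisRepresentations

noncomputable section

/-! ### Ring homomorphisms into local rings with finite residue field are local -/

/-- **A ring homomorphism from a local ring to a local ring with finite residue field is local**:
`ψ(𝔪_R) ⊆ 𝔪_A`.  Indeed the kernel of `R → A → k_A` is a prime ideal `Q` with `R/Q ↪ k_A` finite; a
finite domain is a field, so `Q` is maximal, `Q = 𝔪_R`. [folklore] -/
theorem map_maximalIdeal_le_of_finite_residueField {R A : Type*} [CommRing R] [IsLocalRing R]
    [CommRing A] [IsLocalRing A] [Finite (ResidueField A)] (ψ : R →+* A) :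
    (maximalIdeal R).map ψ ≤ maximalIdeal A := by
  -- the composite to the residue field and its kernel
  set θ : R →+* ResidueField A := (residue A).comp ψ with hθ
  haveI hprime : (RingHom.ker θ).IsPrime := RingHom.ker_isPrime θ
  haveI : Finite (R ⧸ RingHom.ker θ) :=
    Finite.of_injective _ (RingHom.kerLift_injective θ)
  have hfield : IsField (R ⧸ RingHom.ker θ) := Finite.isField_of_domain _
  have hmax : (RingHom.ker θ).IsMaximal := Ideal.Quotient.maximal_of_isField _ hfield
  have hker : RingHom.ker θ = maximalIdeal R := IsLocalRing.eq_maximalIdeal hmax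
  rw [Ideal.map_le_iff_le_comap]
  intro r hr
  rw [← hker, RingHom.mem_ker, hθ, RingHom.comp_apply, residue_eq_zero_iff] at hr
  exact hr

/-! ### Automatic continuity of `𝒪_E`-valued points -/

section Continuity

variable {p : ℕ} [Fact p.Prime] (L : IntermediateField ℚ_[p] (PadicAlgCl p)) [FiniteDimensional ℚ_[p] L]

/-- **Automatic continuity.**  For a local ring `R` and ANY ring homomorphism `ψ : R → 𝒪_L`
(`L/ℚ_p` finite), the composite `R → 𝒪_L ⊆ ℚ̄_p` is continuous from the `𝔪_R`-adic topology to the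
`p`-adic topology: `ψ` is local (finite residue field of `𝒪_L`), so `ψ(𝔪_Rⁿ) ⊆ 𝔪_Lⁿ`, whose elements
have norm `≤ ‖ϖ_L‖ⁿ → 0`. [cite: SerreLocalFields1979, Ch. II §1] -/
theorem continuous_coe_comp_intermediateFieldIntegers {R : Type*} [CommRing R] [IsLocalRing R]
    (ψ : R →+* intermediateFieldIntegers p L) :
    @Continuous R (PadicAlgCl p) (maximalIdeal R).adicTopology _
      (((algebraMap L (PadicAlgCl p)).comp (intermediateFieldIntegers p L).subtype).comp ψ) := by
  letI : WithIdeal R := ⟨maximalIdeal R⟩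
  haveI := intermediateFieldIntegers.finite_residueField L
  have hloc := map_maximalIdeal_le_of_finite_residueField ψ
  refine continuous_of_continuousAt_zero
    (((algebraMap L (PadicAlgCl p)).comp (intermediateFieldIntegers p L).subtype).comp ψ) ?_
  rw [ContinuousAt, map_zero, ((maximalIdeal R).hasBasis_nhds_zero_adic).tendsto_iff Metric.nhds_basis_ball]
  intro ε hε
  -- `‖ϖ‖ⁿ < ε` for large `n`
  obtain ⟨n, hn⟩ := ((tendsto_pow_atTop_nhds_zero_of_lt_one (norm_nonneg _)
    (intermediateFieldIntegers.norm_uniformizer_lt_one L)).eventually (gt_mem_nhds hε)).exists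
  refine ⟨n, trivial, fun r hr => ?_⟩
  have hmem : ψ r ∈ maximalIdeal (intermediateFieldIntegers p L) ^ n := by
    have : r ∈ (maximalIdeal R) ^ n := hr
    have h2 : ψ r ∈ ((maximalIdeal R) ^ n).map ψ := Ideal.mem_map_of_mem _ this
    rw [Ideal.map_pow] at h2
    exact Ideal.pow_right_mono hloc n h2
  have hnorm := (intermediateFieldIntegers.mem_maximalIdeal_pow_iff L n (ψ r)).mp hmem
  rw [Metric.mem_ball, dist_zero_right]
  change ‖(((ψ r : intermediateFieldIntegers p L) : L) : PadicAlgCl p)‖ < ε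
  rw [← intermediateFieldIntegers.norm_coe]
  exact lt_of_le_of_lt hnorm hn

end Continuity

/-! ### The units `q_v` -/

/-- In a local ring whose residue field has characteristic `p`, a natural number not divisible by `p`
is a unit. [folklore] -/
theorem isUnit_natCast_of_not_dvd {R : Type*} [CommRing R] [IsLocalRing R] (p : ℕ) [Fact p.Prime]
    [CharP (ResidueField R) p] {n : ℕ} (hn : ¬ p ∣ n) : IsUnit (n : R) := by
  by_contra h
  have hmem : (n : R) ∈ maximalIdeal R := h
  rw [← residue_eq_zero_iff, map_natCast, CharP.cast_eq_zero_iff (ResidueField R) p] at hmem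
  exact hn hmem

/-- For a finite place `v` of a number field not above `p`, `p ∤ N(v)` (`N(v)` is a power of the
rational prime UNDER `v`). [folklore] -/
theorem not_dvd_absNorm_of_not_mem {F : Type*} [Field F] [NumberField F] (p : ℕ) [Fact p.Prime]
    (v : HeightOneSpectrum (𝓞 F)) (hv : (p : 𝓞 F) ∉ v.asIdeal) : ¬ p ∣ Ideal.absNorm v.asIdeal := by
  classical
  intro hdvd
  -- the residue field `𝓞_F / v` is a finite field of cardinality `N(v) = ℓⁿ`, `ℓ` its characteristic
  haveI : Finite (𝓞 F ⧸ v.asIdeal) := Ideal.finiteQuotientOfFreeOfNeBot v.asIdeal v.ne_bot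
  letI : Fintype (𝓞 F ⧸ v.asIdeal) := Fintype.ofFinite _
  haveI : v.asIdeal.IsMaximal := v.isPrime.isMaximal v.ne_bot
  letI : Field (𝓞 F ⧸ v.asIdeal) := Ideal.Quotient.field v.asIdeal
  haveI hchar : CharP (𝓞 F ⧸ v.asIdeal) (ringChar (𝓞 F ⧸ v.asIdeal)) := ringChar.charP _
  obtain ⟨n, hℓ, hcard⟩ := FiniteField.card (𝓞 F ⧸ v.asIdeal) (ringChar (𝓞 F ⧸ v.asIdeal))
  have hq : Ideal.absNorm v.asIdeal = Fintype.card (𝓞 F ⧸ v.asIdeal) := by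
    rw [Ideal.absNorm_apply, Submodule.cardQuot_apply, Nat.card_eq_fintype_card]
  rw [hq, hcard] at hdvd
  -- `p ∣ ℓⁿ` forces `p = ℓ`, so `p = 0` in `𝓞_F / v`, i.e. `p ∈ v`
  have hpl : p = ringChar (𝓞 F ⧸ v.asIdeal) :=
    (Nat.prime_dvd_prime_iff_eq Fact.out hℓ).mp ((Fact.out : p.Prime).dvd_of_dvd_pow hdvd)
  apply hv
  rw [← Ideal.Quotient.eq_zero_iff_mem, map_natCast, hpl]
  exact CharP.cast_eq_zero _ _

variable {F : Type} [Field F] [NumberField F] {p : ℕ} [Fact p.Prime]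
variable {𝒪 : Type} [CommRing 𝒪] {k : Type} [Field k] [Algebra 𝒪 k] {𝒟 : NearlyOrdinaryDatum F p 𝒪 k}
variable (𝓡 : NearlyOrdinaryDeformationRing.{0} 𝒟)

omit [Fact p.Prime] in
/-- The residue field of `R_𝒟` has characteristic `p` when `k` has. [folklore] -/
theorem charP_residueField [CharP k p] : CharP (ResidueField 𝓡.R) p := by
  have e : ResidueField 𝓡.R ≃+* k :=
    (Ideal.quotEquivOfEq 𝓡.ker_π.symm).trans (RingHom.quotientKerEquivOfSurjective 𝓡.π_surjective)
  exact charP_of_injective_ringHom (f := e.symm.toRingHom) e.symm.injective p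

/-! ### The dictionary for `𝒪_E`-valued points, unconditionally -/

/-- `q_v = N(v)` is a unit of `R_𝒟` for every `v ∤ p`, when `k` has characteristic `p`. [folklore] -/
theorem isUnit_natCast_absNorm [CharP k p] (v : HeightOneSpectrum (𝓞 F)) (hv : (p : 𝓞 F) ∉ v.asIdeal) :
    IsUnit ((Ideal.absNorm v.asIdeal : ℕ) : 𝓡.R) := by
  haveI := charP_residueField 𝓡
  exact isUnit_natCast_of_not_dvd p (not_dvd_absNorm_of_not_mem p v hv)

/-- **ENTRANCE, unconditional form.**  `k` finite of characteristic `p`; `ψ : R_𝒟 → 𝒪_L` ANY ring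
homomorphism (`L/ℚ_p` finite inside `ℚ̄_p`) whose composite `φ : R_𝒟 → ℚ̄_p` realises the continuous
`r : Γ_F → GL₂(ℚ̄_p)` up to conjugation; if `r` is `p`-adically automorphic of level `𝒰` then `ker φ`
is a pro-modular prime of `R_𝒟` at level `𝒰`.  (Continuity of `φ` and `q_v ∈ R_𝒟ˣ` are automatic.)
[cite: SkinnerWiles1999, §4.1 p. 62] -/
theorem isProModularPrimeAt_ker_of_isPadicallyAutomorphic_intermediateFieldIntegers [Finite k] [CharP k p]
    (𝒰 : TameLevel 2 F p) (L : IntermediateField ℚ_[p] (PadicAlgCl p)) [FiniteDimensional ℚ_[p] L]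
    (ψ : 𝓡.R →+* intermediateFieldIntegers p L)
    (r : FramedGaloisRep F (PadicAlgCl p) 2) (P : GL (Fin 2) (PadicAlgCl p))
    (hreal : ∀ g, Matrix.GeneralLinearGroup.map
      ((((algebraMap L (PadicAlgCl p)).comp (intermediateFieldIntegers p L).subtype).comp ψ)) (𝓡.ρ g) =
        P⁻¹ * r g * P)
    (hr : 𝒰.IsPadicallyAutomorphic r) :
    IsProModularPrimeAt 𝓡 𝒰
      ⟨RingHom.ker (((algebraMap L (PadicAlgCl p)).comp (intermediateFieldIntegers p L).subtype).comp ψ),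
        ker_isPrime 𝓡 _⟩ :=
  isProModularPrimeAt_ker_of_isPadicallyAutomorphic 𝓡 𝒰 _
    (continuous_coe_comp_intermediateFieldIntegers L ψ)
    (fun v hv => isUnit_natCast_absNorm 𝓡 v fun h => hv (𝒰.mem_bad_of_mem v h)) r P hreal hr

/-- **EXIT, unconditional form.**  If the prime `ker φ` of an `𝒪_L`-valued point `φ = (𝒪_L ⊆ ℚ̄_p) ∘ ψ`
of `R_𝒟` is pro-modular at level `𝒰` and `φ ∘ ρ_𝒟` is conjugate to the continuous
`ρ : Γ_F → GL₂(ℚ̄_p)`, then `ρ` is `p`-adically automorphic of level `𝒰`.  (Continuity automatic.)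
[cite: SkinnerWiles1999, §4.1 p. 62] -/
theorem isPadicallyAutomorphic_of_isProModularPrimeAt_ker_intermediateFieldIntegers
    (𝒰 : TameLevel 2 F p) (L : IntermediateField ℚ_[p] (PadicAlgCl p)) [FiniteDimensional ℚ_[p] L]
    (ψ : 𝓡.R →+* intermediateFieldIntegers p L)
    (ρ : FramedGaloisRep F (PadicAlgCl p) 2) (P : GL (Fin 2) (PadicAlgCl p))
    (hreal : ∀ g, Matrix.GeneralLinearGroup.map
      ((((algebraMap L (PadicAlgCl p)).comp (intermediateFieldIntegers p L).subtype).comp ψ)) (𝓡.ρ g) =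
        P⁻¹ * ρ g * P)
    (hpro : IsProModularPrimeAt 𝓡 𝒰
      ⟨RingHom.ker (((algebraMap L (PadicAlgCl p)).comp (intermediateFieldIntegers p L).subtype).comp ψ),
        ker_isPrime 𝓡 _⟩) :
    𝒰.IsPadicallyAutomorphic ρ :=
  isPadicallyAutomorphic_of_isProModularPrimeAt_ker 𝓡 𝒰 _
    (continuous_coe_comp_intermediateFieldIntegers L ψ) ρ P hreal hpro

end

end Summit.Langlands.Langlands.Cruxes.ReducibleOrdinaryProModular.SteinbergHyperplane
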